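import Summits.Ventures.CertifiedManyBodySolver.Theorems.M3x2EdgeSplitSymReplayBoxCanon

/-!
# E4 — PACKED PIPE TWIN of the SymReplay box pipe `canonNFZB`: executable definitions + the BRIDGE as kernel-elaborated
SIGNATURES (pen hub-lb-sym-plan-1 g4, 2026-08-28; crux workfile for stmt-Ventures-22024, memo EBUDGET-600 rev 2 lever L1).

WHAT.  A letter inside the certificate's box `[lo, hi]` becomes ONE natural number
`encL lo hi ℓ = 4·rank(ℓ.x) + 2·spin + (1 − dag)` (hub-lb-sym-ref-1's packing, `engine/H_base.lean` (b)), with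
`rank (a, b) = (a − lo.1)·W + (b − lo.2)`, `W = hi.2 − lo.2 + 1`, so that `Letter.blt` IS `<` on `ℕ`, `modeEq` IS «equal halves»,
and no `Fin 2 → ℤ` closure is touched in the hot loop.  The packed pipe `pcanonNFZB` = `pnfPoly` → `pcollect2` → `pdropZeros` →
`pcanonTermAB` mirrors `canonNFZB lo hi = (dropZeros (collect (nfPoly p))).flatMap (canonTermAB lo hi)` (…BoxCanon l.184)
definition by definition; the affine-`D₄` box canon works on DECODED small integer pairs and re-encodes after the `inBox` test.

THE BRIDGE (statements below, bodies `sorry` = the engine item; sizes are estimates): (a) codes — `decL_encL`, `blt_eq_encL_lt`,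
`beq_eq_encL_beq` (≈ 80 l.); (b) `pinsL_agree`, `pnfWord_agree`, `pcollect2_agree`, `pdropZeros_agree` (≈ 200 l.; the functions are the
SAME structural recursions through an order-isomorphism; sym-ref-1's `PCollect2Sound.lean` 4ec5d0aa already gives the semantic half);
(c) `pd4_agree`, `panchoredNFs_agree`, `pcanonAB_agree` (≈ 150 l.); (c′) FAST canon stage `pnfWordF` = sort-with-parity, one
term, no `ℚ`, and (c″) the decode-once anchor `panchorD` (`pnfWordF_eq`, `panchorD_eq`, `pcanonABF_eq`, `pcanonNFZBF_eq`,
≈ 150 l., packed-side only); (d) `pcanonNFZB_agree`, `pisZero_encP`,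
**`isZero_canonNFZB_of_packed : psuppInB lo hi p = true → pisZero (pcanonNFZB lo hi (encP lo hi p)) = true →
isZero (canonNFZB lo hi p) = true`** (≈ 60 l.) — the one lemma an OUTROUTE fact slot consumes (`OutFactsSB` takes Booleans: the
module proves the packed Boolean by `native_decide` and transports, exactly the `shareRFastM_perm` / `_eq` pattern of T20c).
Inputs are in the box because every letter of a module share comes from a certificate word (basis words, base words): ONE
cheap per-certificate fact `wordsInBox…` + `inBox_append` / letters-preserved-by-`nfWord` close `psuppInB` of every share.

MEASURED / PREDICTED (EBUDGET-600 §4 L1): packed nf ×2.4, gen+nf+collect2 ×6 (sym-ref-1, farm); packed box canon UNMEASURED —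
predicted 20–50 µs/term against 1.8 ms/call (sym-ref-2 #11 model) ⇒ pipe ÷8–15.  `E4Bench.lean` (same folder) is the one-call
micro-bench that decides it.  Nothing here is landed; no certificate is replayed; no bound of record moves (#529 −0.8295699476;
22024 met BY VALUE only, un-landed; 21721 open by +0.0296); no summit or crux statement is proved; nothing here predicts
superconductivity.
-/

namespace Summit.Ventures.CertifiedManyBodySolver.Cruxes.LowerEdge_ge_m83o100.E4Spec

open Literature.Probability.LatticeModels (Site)
open Summit.Ventures.CertifiedManyBodySolver.Theorems.SymReplay

/-! ## (a) Letter codes inside the box `[lo, hi]` -/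

/-- Row width of the box (number of `x 1` values). -/
def boxW (lo hi : ℤ × ℤ) : ℕ := (hi.2 - lo.2 + 1).toNat

/-- Lexicographic rank of a box site: `(a − lo.1)·W + (b − lo.2)` (monotone in the tree's `siteLt` inside the box). -/
def siteRank (lo hi : ℤ × ℤ) (x : Site 2) : ℕ := (x 0 - lo.1).toNat * boxW lo hi + (x 1 - lo.2).toNat

/-- **Packed letter**: `4·rank + 2·spin + (1 − dag)` — creators of a mode sort BEFORE its annihilators, as in `Letter.blt`. -/
def encL (lo hi : ℤ × ℤ) (ℓ : Letter) : ℕ := 4 * siteRank lo hi ℓ.x + 2 * ℓ.s.val + (if ℓ.dag then 0 else 1)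

/-- Decode a rank to the box site. -/
def decSite (lo hi : ℤ × ℤ) (r : ℕ) : Site 2 := mkSite (lo.1 + ((r / boxW lo hi : ℕ) : ℤ)) (lo.2 + ((r % boxW lo hi : ℕ) : ℤ))

/-- Decode a packed letter. -/
def decL (lo hi : ℤ × ℤ) (a : ℕ) : Letter := ⟨decSite lo hi (a / 4), ⟨(a / 2) % 2, Nat.mod_lt _ (by decide)⟩, a % 2 == 0⟩

abbrev PWord := List ℕ
abbrev PPoly := List (ℚ × PWord)

/-- Packed word / polynomial (letter order kept). -/
def encW (lo hi : ℤ × ℤ) (w : Word) : PWord := w.map (encL lo hi)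
def encP (lo hi : ℤ × ℤ) (p : QPoly) : PPoly := p.map fun t => (t.1, encW lo hi t.2)

/-! ## (b) Packed normal order and collector (hub-lb-sym-ref-1 `H_base.lean` (b), verbatim) -/

@[inline] def pdag (a : ℕ) : Bool := a % 2 == 0
@[inline] def pmodeEq (a b : ℕ) : Bool := a / 2 == b / 2
@[inline] def pmodeLt (a b : ℕ) : Bool := decide (a / 2 < b / 2)

def pwordEq : PWord → PWord → Bool
  | [], [] => true
  | a :: u, b :: v => a == b && pwordEq u v
  | _, _ => false

def pwordLt : PWord → PWord → Bool
  | [], [] => false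
  | [], _ :: _ => true
  | _ :: _, [] => false
  | a :: u, b :: v => decide (a < b) || (a == b && pwordLt u v)

def pconsNeg (m : ℕ) (p : PPoly) : PPoly := p.map fun t => (-t.1, m :: t.2)

/-- `insL` verbatim with packed comparisons. -/
def pinsL (ℓ : ℕ) : PWord → PPoly
  | [] => [(1, [ℓ])]
  | m :: rest =>
    if pdag ℓ then
      if pdag m then
        if pmodeEq ℓ m then [] else if pmodeLt ℓ m then [(1, ℓ :: m :: rest)] else pconsNeg m (pinsL ℓ rest)
      else [(1, ℓ :: m :: rest)]
    else
      if pdag m then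
        (if pmodeEq ℓ m then [((1 : ℚ), rest)] else []) ++ pconsNeg m (pinsL ℓ rest)
      else
        if pmodeEq ℓ m then [] else if pmodeLt ℓ m then [(1, ℓ :: m :: rest)] else pconsNeg m (pinsL ℓ rest)

def pnfWord : PWord → PPoly
  | [] => [(1, [])]
  | ℓ :: w => (pnfWord w).flatMap fun t => (pinsL ℓ t.2).map fun t' => (t.1 * t'.1, t'.2)

def ppscale (q : ℚ) (p : PPoly) : PPoly := p.map fun t => (q * t.1, t.2)
def pnfPoly (p : PPoly) : PPoly := p.flatMap fun t => ppscale t.1 (pnfWord t.2)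

/-- Fuel-structural merge (= the tree's `mergeF` with `pwordLt`). -/
def pmergeF : ℕ → PPoly → PPoly → PPoly
  | 0, p, q => p ++ q
  | _ + 1, [], q => q
  | _ + 1, t :: p, [] => t :: p
  | n + 1, t :: p, t' :: q => if pwordLt t'.2 t.2 then t' :: pmergeF n (t :: p) q else t :: pmergeF n p (t' :: q)

def pmergePairs (n : ℕ) : List PPoly → List PPoly
  | p :: q :: rest => pmergeF n p q :: pmergePairs n rest
  | l => l

def pmergeAll : ℕ → ℕ → List PPoly → PPoly
  | _, _, [] => []
  | _, _, [p] => p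
  | 0, _, l => l.foldr (· ++ ·) []
  | k + 1, n, l => pmergeAll k n (pmergePairs n l)

def psortW (p : PPoly) : PPoly := pmergeAll p.length p.length (p.map fun t => [t])

def pmergeAdj : PPoly → PPoly
  | [] => []
  | t :: rest =>
    match pmergeAdj rest with
    | [] => [t]
    | t' :: rest' => if pwordEq t.2 t'.2 then (t.1 + t'.1, t.2) :: rest' else t :: t' :: rest'

/-- Packed collector (= `collect` = `mergeAdj ∘ sortW`). -/
def pcollect2 (p : PPoly) : PPoly := pmergeAdj (psortW p)

def pdropZeros (p : PPoly) : PPoly := p.filter fun t => !decide (t.1 = 0)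

def pisZero (p : PPoly) : Bool := (pcollect2 p).all fun t => decide (t.1 = 0)

/-! ## (c) Packed affine-`D₄` BOX canon (decoded small integers inside, codes outside) -/

/-- The eight linear maps in the ORDER of the tree's `d4All = [r0, r1, r2, r3, sr0, sr1, sr2, sr3]`
(`rot (a,b) = (−b,a)`, `refl (a,b) = (a,−b)`, `r i = rotⁱ`, `sr i = refl ∘ rotⁱ`). -/
def pd4 (k : ℕ) (ab : ℤ × ℤ) : ℤ × ℤ :=
  let a := ab.1; let b := ab.2
  match k with
  | 0 => (a, b) | 1 => (-b, a) | 2 => (-a, -b) | 3 => (b, -a)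
  | 4 => (a, -b) | 5 => (-b, -a) | 6 => (-a, b) | _ => (b, a)

/-- Decode a packed letter to `(a, b, tail)` with `tail = 2·spin + (1 − dag)`. -/
def decAB (lo hi : ℤ × ℤ) (c : ℕ) : ℤ × ℤ × ℕ :=
  let r := c / 4
  (lo.1 + ((r / boxW lo hi : ℕ) : ℤ), lo.2 + ((r % boxW lo hi : ℕ) : ℤ), c % 4)

/-- `minCornerP` on decoded triples (same recursion, same junk `(0,0)` on `[]`). -/
def pminCorner : List (ℤ × ℤ × ℕ) → ℤ × ℤ
  | [] => (0, 0)
  | [x] => (x.1, x.2.1)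
  | x :: l => let m := pminCorner l; (min x.1 m.1, min x.2.1 m.2)

/-- Box test on a decoded pair. -/
def pinBox (lo hi : ℤ × ℤ) (ab : ℤ × ℤ) : Bool :=
  decide (lo.1 ≤ ab.1) && decide (ab.1 ≤ hi.1) && decide (lo.2 ≤ ab.2) && decide (ab.2 ≤ hi.2)

/-- Re-encode a decoded in-box triple. -/
def encAB (lo hi : ℤ × ℤ) (t : ℤ × ℤ × ℕ) : ℕ :=
  4 * ((t.1 - lo.1).toNat * boxW lo hi + (t.2.1 - lo.2).toNat) + t.2.2

/-- The `k`-th anchored copy of a packed word: move by `pd4 k`, translate its min corner to `lo`, keep it iff it fits the box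
(= the body of `anchoredNFsB` before `nfWord`). -/
def panchor (lo hi : ℤ × ℤ) (k : ℕ) (u : PWord) : Option PWord :=
  let mv := u.map fun c => let t := decAB lo hi c; let ab := pd4 k (t.1, t.2.1); (ab.1, ab.2, t.2.2)
  let m := pminCorner mv
  let w := mv.map fun t => (t.1 + (lo.1 - m.1), t.2.1 + (lo.2 - m.2), t.2.2)
  if w.all (fun t => pinBox lo hi (t.1, t.2.1)) then some (w.map (encAB lo hi)) else none

/-- `anchoredNFsB` packed. -/
def panchoredNFs (lo hi : ℤ × ℤ) (u : PWord) : List PPoly :=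
  (List.range 8).filterMap fun k => (panchor lo hi k u).map pnfWord

def ppolyKeyLt : PPoly → PPoly → Bool
  | [], [] => false
  | [], _ :: _ => true
  | _ :: _, [] => false
  | t :: _, t' :: _ => pwordLt t.2 t'.2

def ppolyNegEq : PPoly → PPoly → Bool
  | [], [] => true
  | t :: p, t' :: q => pwordEq t.2 t'.2 && decide (t'.1 = -t.1) && ppolyNegEq p q
  | _, _ => false

/-- `canonAB` packed. -/
def pcanonAB (lo hi : ℤ × ℤ) (u : PWord) : PPoly :=
  match panchoredNFs lo hi u with
  | [] => [(1, u)]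
  | c :: cs =>
    let best := cs.foldl (fun b c' => if ppolyKeyLt c' b then c' else b) c
    if (c :: cs).any (ppolyNegEq best) then [] else best

/-- `canonTermAB` packed. -/
def pcanonTermAB (lo hi : ℤ × ℤ) (t : ℚ × PWord) : PPoly := ppscale t.1 (pcanonAB lo hi t.2)

/-- **The packed box pipe** (= `canonNFZB lo hi`). -/
def pcanonNFZB (lo hi : ℤ × ℤ) (p : PPoly) : PPoly :=
  (pdropZeros (pcollect2 (pnfPoly p))).flatMap (pcanonTermAB lo hi)

/-! ## (c′) FAST normal form for the canon stage: SORT-WITH-PARITY, no `ℚ`, one term.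
A moved copy of a normal-ordered word is (creators, any mode order) ++ (annihilators, any mode order) with pairwise
distinct letters, so its normal form is ONE term `±(sorted creators ++ sorted annihilators)`, sign = parity of the two
sorting permutations; no contraction can occur.  `pnfWordF` takes that path when the shape test passes and FALLS BACK to
`pnfWord` otherwise, so `pnfWordF = pnfWord` holds for EVERY word (lemma `pnfWordF_eq`, packed-side only, no encode
hypothesis) — the pipe may use it unconditionally. -/

/-- Insert a code into an ascending list, flipping the parity once per element skipped; `none` on a repeated code. -/
def insPar (c : ℕ) : PWord → Option (Bool × PWord)
  | [] => some (false, [c])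
  | d :: l =>
    if c < d then some (false, c :: d :: l)
    else if c == d then none
    else match insPar c l with
      | none => none
      | some (p, l') => some (!p, d :: l')

/-- Sort ascending with the parity of the sorting permutation; `none` on a repeated code. -/
def sortPar : PWord → Option (Bool × PWord)
  | [] => some (false, [])
  | c :: l =>
    match sortPar l with
    | none => none
    | some (p, l') =>
      match insPar c l' with
      | none => none
      | some (q, l'') => some (xor p q, l'')

/-- One-term normal form of a (creators ++ annihilators) word with distinct letters; `none` if the shape test fails. -/
def splitCA : PWord → Option (PWord × PWord)
  | [] => some ([], [])
  | c :: l =>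
    if c % 2 == 0 then
      match splitCA l with
      | none => none
      | some (cs, anns) => some (c :: cs, anns)
    else if l.all (fun d => d % 2 == 1) then some ([], c :: l) else none

def pnfFast (w : PWord) : Option (Bool × PWord) :=
  match splitCA w with
  | none => none
  | some (cs, anns) =>
    match sortPar cs, sortPar anns with
    | some (p, cs'), some (q, as') => some (xor p q, cs' ++ as')
    | _, _ => none

/-- `pnfWord` with the fast path (equal to `pnfWord` on every input — lemma `pnfWordF_eq`). -/
def pnfWordF (w : PWord) : PPoly :=
  match pnfFast w with
  | some (p, w') => [((if p then (-1 : ℚ) else 1), w')]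
  | none => pnfWord w

/-! ## (c″) DECODE-ONCE anchor: decode the word once (not once per map), then per map ONE image pass + min + ONE fused
translate/box-test/re-encode pass (no `all`, no second `map`).  `pcanonABD = pcanonAB` on every input (lemma `pcanonABD_eq`,
packed side only).  (An allocation-free integer-only variant that re-derives the image coordinates three times per letter was
MEASURED slower — 624 ms vs 411 ms anchor stage on 15 296 copies — the interpreted cost is arithmetic-bound, not
allocation-bound; it is not kept.) -/

/-- Box test on two scalars. -/
@[inline] def pinBox2 (lo hi : ℤ × ℤ) (a b : ℤ) : Bool :=
  decide (lo.1 ≤ a) && decide (a ≤ hi.1) && decide (lo.2 ≤ b) && decide (b ≤ hi.2)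

/-- Images of decoded letters under map `k` (same table as `pd4`). -/
def imgsD (k : ℕ) (dec : List (ℤ × ℤ × ℕ)) : List (ℤ × ℤ × ℕ) :=
  dec.map fun t => let ab := pd4 k (t.1, t.2.1); (ab.1, ab.2, t.2.2)

/-- Fused translate + box test + re-encode. -/
def reencD (lo hi : ℤ × ℤ) (da db : ℤ) : List (ℤ × ℤ × ℕ) → Option PWord
  | [] => some []
  | t :: l =>
    let a := t.1 + da
    let b := t.2.1 + db
    if pinBox2 lo hi a b then
      match reencD lo hi da db l with
      | none => none
      | some l' => some ((4 * ((a - lo.1).toNat * boxW lo hi + (b - lo.2).toNat) + t.2.2) :: l')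
    else none

/-- `panchor` on a pre-decoded word. -/
def panchorD (lo hi : ℤ × ℤ) (k : ℕ) (dec : List (ℤ × ℤ × ℕ)) : Option PWord :=
  let mv := imgsD k dec
  let m := pminCorner mv
  reencD lo hi (lo.1 - m.1) (lo.2 - m.2) mv

/-- The eight anchored normal forms (fast nf), explicit recursion on `k`, same order as `List.range 8`. -/
def anchoredD (lo hi : ℤ × ℤ) (dec : List (ℤ × ℤ × ℕ)) : ℕ → List PPoly → List PPoly
  | 0, acc => acc
  | k + 1, acc =>
    match panchorD lo hi k dec with
    | none => anchoredD lo hi dec k acc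
    | some w => anchoredD lo hi dec k (pnfWordF w :: acc)

/-- `panchoredNFs` / `pcanonAB` / `pcanonTermAB` / `pcanonNFZB` with decode-once anchoring and the fast normal form. -/
def panchoredNFsF (lo hi : ℤ × ℤ) (u : PWord) : List PPoly :=
  anchoredD lo hi (u.map (decAB lo hi)) 8 []

def pcanonABF (lo hi : ℤ × ℤ) (u : PWord) : PPoly :=
  match panchoredNFsF lo hi u with
  | [] => [(1, u)]
  | c :: cs =>
    let best := cs.foldl (fun b c' => if ppolyKeyLt c' b then c' else b) c
    if (c :: cs).any (ppolyNegEq best) then [] else best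

def pcanonTermABF (lo hi : ℤ × ℤ) (t : ℚ × PWord) : PPoly := ppscale t.1 (pcanonABF lo hi t.2)

def pcanonNFZBF (lo hi : ℤ × ℤ) (p : PPoly) : PPoly :=
  (pdropZeros (pcollect2 (pnfPoly p))).flatMap (pcanonTermABF lo hi)

/-! ## Kernel toys: the packed pipe agrees with the tree's on small words in the box `[−1,1]²` (`decide +kernel`). -/

section Toys
private def tlo : ℤ × ℤ := ((-1 : ℤ), (-1 : ℤ))
private def thi : ℤ × ℤ := ((1 : ℤ), (1 : ℤ))
private def tu1 : Word := [cre (mkSite 1 0) 0, ann (mkSite 0 (-1)) 0]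
private def tu2 : Word := [ann (mkSite 1 1) 1, cre (mkSite 1 1) 1, cre (mkSite (-1) 0) 0]
private def tu3 : Word := [cre (mkSite 0 0) 0, cre (mkSite 0 1) 1, ann (mkSite 0 1) 1, ann (mkSite 0 0) 0]

example : pnfWord (encW tlo thi tu2) = encP tlo thi (nfWord tu2) := by decide +kernel
example : pcanonAB tlo thi (encW tlo thi tu1) = encP tlo thi (canonAB tlo thi tu1) := by decide +kernel
example : pcanonAB tlo thi (encW tlo thi tu3) = encP tlo thi (canonAB tlo thi tu3) := by decide +kernel
example : pcanonNFZB tlo thi (encP tlo thi [((1 : ℚ), tu1 ++ tu2), ((-2 : ℚ), tu3), ((1 : ℚ), tu2)]) =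
    encP tlo thi (canonNFZB tlo thi [((1 : ℚ), tu1 ++ tu2), ((-2 : ℚ), tu3), ((1 : ℚ), tu2)]) := by decide +kernel
example : (List.range 8).map (fun k => panchorD tlo thi k ((encW tlo thi tu3).map (decAB tlo thi))) =
    (List.range 8).map (fun k => panchor tlo thi k (encW tlo thi tu3)) := by decide +kernel
/-- The FAST canon stage agrees too (same toys; `tu2` is not normal-ordered ⇒ exercises the fallback). -/
example : pnfWordF (encW tlo thi tu2) = pnfWord (encW tlo thi tu2) ∧ pnfWordF (encW tlo thi tu3) = pnfWord (encW tlo thi tu3) ∧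
    pcanonABF tlo thi (encW tlo thi tu1) = encP tlo thi (canonAB tlo thi tu1) ∧
    pcanonNFZBF tlo thi (encP tlo thi [((1 : ℚ), tu1 ++ tu2), ((-2 : ℚ), tu3), ((1 : ℚ), tu2)]) =
    encP tlo thi (canonNFZB tlo thi [((1 : ℚ), tu1 ++ tu2), ((-2 : ℚ), tu3), ((1 : ℚ), tu2)]) := by decide +kernel
/-- Non-square box `[−1,1] × [−1,0]` (row width `W = 2`): rotated copies of a 3-wide word do NOT fit — exercises the `none`
branch of `panchor` and a rank with `W ≠` box height. -/
private def nlo : ℤ × ℤ := ((-1 : ℤ), (-1 : ℤ))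
private def nhi : ℤ × ℤ := ((1 : ℤ), (0 : ℤ))
private def tu4 : Word := [cre (mkSite (-1) 0) 0, cre (mkSite 0 0) 0, ann (mkSite 1 (-1)) 1]
example : (panchoredNFs nlo nhi (encW nlo nhi tu4)).length = (anchoredNFsB nlo nhi tu4).length ∧
    (anchoredNFsB nlo nhi tu4).length < 8 ∧
    pcanonAB nlo nhi (encW nlo nhi tu4) = encP nlo nhi (canonAB nlo nhi tu4) := by decide +kernel
end Toys

/-! ## (d) THE BRIDGE — signatures (bodies are the engine item; `sorry` here by design of a spec workfile) -/

section Bridge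
variable {lo hi : ℤ × ℤ}

/-- (a1) Round trip on box letters. -/
theorem decL_encL (ℓ : Letter) (h : inBoxSite lo hi ℓ.x = true) : decL lo hi (encL lo hi ℓ) = ℓ := by sorry

/-- (a2) The code is an ORDER ISOMORPHISM for `Letter.blt` on box letters … -/
theorem blt_eq_encL_lt (a b : Letter) (ha : inBoxSite lo hi a.x = true) (hb : inBoxSite lo hi b.x = true) :
    a.blt b = decide (encL lo hi a < encL lo hi b) := by sorry

/-- (a3) … respects `modeEq` / `modeLt` / `beq` likewise. -/
theorem modeEq_eq_pmodeEq (a b : Letter) (ha : inBoxSite lo hi a.x = true) (hb : inBoxSite lo hi b.x = true) :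
    a.modeEq b = pmodeEq (encL lo hi a) (encL lo hi b) ∧ a.modeLt b = pmodeLt (encL lo hi a) (encL lo hi b) ∧
    a.beq b = (encL lo hi a == encL lo hi b) ∧ a.dag = pdag (encL lo hi a) := by sorry

/-- (b1) `insL` agreement. -/
theorem pinsL_agree (ℓ : Letter) (w : Word) (hℓ : inBoxSite lo hi ℓ.x = true) (hw : inBox lo hi w = true) :
    pinsL (encL lo hi ℓ) (encW lo hi w) = encP lo hi (insL ℓ w) := by sorry

/-- (b2) `nfWord` agreement. -/
theorem pnfWord_agree (w : Word) (hw : inBox lo hi w = true) : pnfWord (encW lo hi w) = encP lo hi (nfWord w) := by sorry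

/-- (b3) `wordLt` / `wordEq` agreement (order-iso lifted to words). -/
theorem pwordLt_agree (u v : Word) (hu : inBox lo hi u = true) (hv : inBox lo hi v = true) :
    pwordLt (encW lo hi u) (encW lo hi v) = wordLt u v ∧ pwordEq (encW lo hi u) (encW lo hi v) = wordEq u v := by sorry

/-- (b4) collector agreement (same structural recursions: `mergeF/mergePairs/mergeAll/sortW/mergeAdj`). -/
theorem pcollect2_agree (p : QPoly) (hp : psuppInB lo hi p = true) : pcollect2 (encP lo hi p) = encP lo hi (collect p) := by
  sorry

/-- (b5) zero filter agreement. -/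
theorem pdropZeros_agree (p : QPoly) : pdropZeros (encP lo hi p) = encP lo hi (dropZeros p) := by sorry

/-- (c1) the eight maps ARE `d4R` in `d4All` order. -/
theorem pd4_agree (x : Site 2) :
    (List.range 8).map (fun k => pd4 k (x 0, x 1)) = d4All.map (fun γ => ((d4R γ x) 0, (d4R γ x) 1)) := by sorry

/-- (c2) anchored copies agree (the `inBox` test included). -/
theorem panchoredNFs_agree (u : Word) (hu : inBox lo hi u = true) :
    panchoredNFs lo hi (encW lo hi u) = (anchoredNFsB lo hi u).map (encP lo hi) := by sorry

/-- (c3) **box canon agreement.** -/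
theorem pcanonAB_agree (u : Word) (hu : inBox lo hi u = true) :
    pcanonAB lo hi (encW lo hi u) = encP lo hi (canonAB lo hi u) := by sorry

/-- (c4) the fast normal form IS `pnfWord`; the decode-once anchor IS `panchor` (packed side only; no encode hypothesis). -/
theorem pnfWordF_eq (w : PWord) : pnfWordF w = pnfWord w := by sorry
theorem panchorD_eq (k : ℕ) (u : PWord) : panchorD lo hi k (u.map (decAB lo hi)) = panchor lo hi k u := by sorry
theorem panchoredNFsF_eq (u : PWord) : panchoredNFsF lo hi u = panchoredNFs lo hi u := by sorry

/-- (c5) hence the fast canon / pipe are the packed canon / pipe. -/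
theorem pcanonABF_eq (u : PWord) : pcanonABF lo hi u = pcanonAB lo hi u := by sorry
theorem pcanonNFZBF_eq (p : PPoly) : pcanonNFZBF lo hi p = pcanonNFZB lo hi p := by sorry

/-- (d1) **pipe agreement.** -/
theorem pcanonNFZB_agree (p : QPoly) (hp : psuppInB lo hi p = true) :
    pcanonNFZB lo hi (encP lo hi p) = encP lo hi (canonNFZB lo hi p) := by sorry

/-- (d2) `isZero` through the code (canon output stays in the box). -/
theorem pisZero_encP (p : QPoly) (hp : psuppInB lo hi p = true) : pisZero (encP lo hi p) = isZero p := by sorry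

/-- (d3) **THE TRANSFER an OUTROUTE fact slot consumes.** -/
theorem isZero_canonNFZB_of_packed (p : QPoly) (hp : psuppInB lo hi p = true)
    (h : pisZero (pcanonNFZB lo hi (encP lo hi p)) = true) : isZero (canonNFZB lo hi p) = true := by sorry

end Bridge

end Summit.Ventures.CertifiedManyBodySolver.Cruxes.LowerEdge_ge_m83o100.E4Spec
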